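import Summits.KontsevichZagierPeriods.KontsevichZagierPeriods.Theorems.HurwitzMicroSectorsNormalFormPrincipleM4SharedTools
import Summits.KontsevichZagierPeriods.KontsevichZagierPeriods.Theorems.HurwitzMicroSectorsNormalFormPrincipleM4BoxSubSimplex4
import Summits.KontsevichZagierPeriods.KontsevichZagierPeriods.Theorems.HyperbolicBlochOffTetraSectorKernelStubAffineOrbit
import Literature.NumberTheory.Transcendental.KZProductIdeal

/-!
# `NormalFormPrinciple` (stmt-KontsevichZagierPeriods-3869), line `SketchIdeator1` —
# leaf `stub_boxRigidity`, layer `M4` packages: the box-stuffle `[ac] ⋆ [ac] = [aaab] − 2[acab]`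

Pure proof file (registered sub-goal `m4_rel_bstuffle22pp` of stmt-KontsevichZagierPeriods-3869,
line `SketchIdeator1`, lead seat c9; layer `M4` packages of the dimension-four campaign of the leaf
`stub_boxRigidity`; `--supports` the crux). Letters on `(0,1)`: `a(u) = 1/u`, `b(u) = 1/(1−u)`,
`c(u) = 1/(1+u)`; the weight-two word `[ac] = [Δ₂, a(t₀)c(t₁)]` (`= ζ(2)/2`) lives on
`Δ₂ = {1 > t₀ > t₁ > 0}`, the weight-four words `[aaab]` (`= ζ(4)`) and `[acab]` on
`Δ₄ = {1 > t₀ > t₁ > t₂ > t₃ > 0}`. The row proved here is the quasi-shuffle (stuffle)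

  `P(ac,ac) − [aaab] + 2[acab] ∈ KZ.relations`,   `P(ac,ac) = [AC.prod AC]`

(values `(ζ(2)/2)² = (5/8)ζ(4)`), realised as a chain of elementary Kontsevich–Zagier moves:
stuffle = ONE integrand-additivity move on the product box (three-term partial fraction) + a
coordinate permutation + cubical charts. In detail:
* the box form `B = [□², 1/(1 + x₀x₁)]` of `[ac]` (cubical chart `(x₀, x₀x₁)`, rule (2),
  `m4_box_sub_simplex2`) and the product ideal (`KZ.Equivalent.prod`): `P(ac,ac) ∼ [B × B]`, whose
  domain is the box `□⁴` and whose integrand is `1/((1 + x₀x₁)(1 + x₂x₃))`;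
* rule (1b) on `□⁴` with the partial fraction (`u = x₀x₁`, `v = x₂x₃`, `Π = uv`)
  `1/((1+u)(1+v)) = 1/((1+u)(1−Π)) + 1/((1+v)(1−Π)) − 1/(1−Π)`: `[B × B] = [T₁] + [T₂] − [T₃]`;
* the coordinate permutation `(x₂, x₃, x₀, x₁)` (rule (2), `KZ.of_sub_of_reindex_mem_relations`)
  identifies `[T₂]` with `[T₁]`;
* the cubical chart `(x₀, x₀x₁, x₀x₁x₂, x₀x₁x₂x₃)` of `□⁴` onto `Δ₄` (rule (2),
  `m4_box_sub_simplex4`) carries `T₃ = [□⁴, 1/(1−Π)]` to `[aaab]` and `T₁` to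
  `[Δ₄, 1/(t₀t₁(1+t₁)t₂(1−t₃))]`, which rule (1b) splits as `[aaab] − [acab]`
  (`1/(t(1+t)) = 1/t − 1/(1+t)`).
Sources: M. Kontsevich, D. Zagier, *Periods* (2001), §1.2 rules (1b), (2), §4.1; M. E. Hoffman,
*The algebra of multiple harmonic series*, J. Algebra 194 (1997) (quasi-shuffle).
No definitions are introduced.
-/

noncomputable section

open MeasureTheory Set
open Literature.NumberTheory.Transcendental Literature.NumberTheory.Transcendental.KZ
open Literature.ModelTheory.ExponentialFields (IsSemialgebraic)
open Summit.KontsevichZagierPeriods.HyperbolicBloch.OffTetraSectorKernel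
  (aff_orbit_of_sub_sum_zsmul_mem_relations)

namespace Summit.KontsevichZagierPeriods.HurwitzMicroSectors.NormalFormPrinciple.PiBox.M3

/-! ## Scalar identities -/

/-- Cancellation `(1/a)·b·a = b` for `a ≠ 0` (the pull-back of the dimension-two cubical chart).
[folklore] -/
private theorem m4l_cancel {a : ℝ} (b : ℝ) (ha : a ≠ 0) : 1 / a * b * a = b := by
  rw [mul_comm (1 / a * b) a, ← mul_assoc, mul_one_div_cancel ha, one_mul]

/-- The stuffle of two `c`-type geometric factors as a three-term partial fraction on `□⁴`
(`u = ab`, `v = cd`, `Π = abcd`):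
`1/(1+u) · 1/(1+v) = 1/((1+u)(1−Π)) + 1/((1+v)(1−Π)) − 1/(1−Π)`. [cite: Hoffman1997, §2] -/
private theorem m4l_partialFraction {a b c d : ℝ} (hu : 1 + a * b ≠ 0) (hv : 1 + c * d ≠ 0)
    (hP : 1 - a * b * c * d ≠ 0) :
    1 / (1 + a * b) * (1 / (1 + c * d)) =
      1 / ((1 + a * b) * (1 - a * b * c * d)) + 1 / ((1 + c * d) * (1 - a * b * c * d)) -
        1 / (1 - a * b * c * d) := by
  rw [one_div_mul_one_div, div_add_div _ _ (mul_ne_zero hu hP) (mul_ne_zero hv hP),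
    div_sub_div _ _ (mul_ne_zero (mul_ne_zero hu hP) (mul_ne_zero hv hP)) hP,
    div_eq_div_iff (mul_ne_zero hu hv)
      (mul_ne_zero (mul_ne_zero (mul_ne_zero hu hP) (mul_ne_zero hv hP)) hP)]
  ring

/-- The split of the charted stuffle box on `Δ₄` into the words `aaab − acab`:
`1/(t₀t₁(1+t₁)t₂(1−t₃)) = a(t₀)a(t₁)a(t₂)b(t₃) − a(t₀)c(t₁)a(t₂)b(t₃)`
(`1/(t(1+t)) = 1/t − 1/(1+t)`). [folklore] -/
private theorem m4l_split {t0 t1 t2 t3 : ℝ} (h0 : t0 ≠ 0) (h1 : t1 ≠ 0) (h1' : 1 + t1 ≠ 0)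
    (h2 : t2 ≠ 0) (h3 : 1 - t3 ≠ 0) :
    1 / (t0 * t1 * (1 + t1) * t2 * (1 - t3)) =
      1 / t0 * (1 / t1) * (1 / t2) * (1 / (1 - t3)) -
        1 / t0 * (1 / (1 + t1)) * (1 / t2) * (1 / (1 - t3)) := by
  have hA : t0 * t1 * t2 * (1 - t3) ≠ 0 := mul_ne_zero (mul_ne_zero (mul_ne_zero h0 h1) h2) h3
  have hB : t0 * (1 + t1) * t2 * (1 - t3) ≠ 0 :=
    mul_ne_zero (mul_ne_zero (mul_ne_zero h0 h1') h2) h3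
  have hL : t0 * t1 * (1 + t1) * t2 * (1 - t3) ≠ 0 :=
    mul_ne_zero (mul_ne_zero (mul_ne_zero (mul_ne_zero h0 h1) h1') h2) h3
  rw [one_div_mul_one_div, one_div_mul_one_div, one_div_mul_one_div, one_div_mul_one_div,
    one_div_mul_one_div, one_div_mul_one_div, div_sub_div _ _ hA hB,
    div_eq_div_iff hL (mul_ne_zero hA hB)]
  ring

/-- Pull-back of the stuffle box `1/((1+x₀x₁)(1−Π))` along the cubical chart
`t = (x₀, x₀x₁, x₀x₁x₂, x₀x₁x₂x₃)` (Jacobian `x₀³x₁²x₂ = t₀t₁t₂`):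
it is `g(t)·x₀³x₁²x₂` with `g(t) = 1/(t₀t₁(1+t₁)t₂(1−t₃))`. [folklore] -/
private theorem m4l_pull1 {a b c d : ℝ} (ha : a ≠ 0) (hb : b ≠ 0) (hc : c ≠ 0)
    (hu : 1 + a * b ≠ 0) (hP : 1 - a * b * c * d ≠ 0) :
    1 / ((1 + a * b) * (1 - a * b * c * d)) =
      1 / (a * (a * b) * (1 + a * b) * (a * b * c) * (1 - a * b * c * d)) *
        (a ^ 3 * b ^ 2 * c) := by
  have hR : a * (a * b) * (1 + a * b) * (a * b * c) * (1 - a * b * c * d) ≠ 0 :=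
    mul_ne_zero (mul_ne_zero (mul_ne_zero (mul_ne_zero ha (mul_ne_zero ha hb)) hu)
      (mul_ne_zero (mul_ne_zero ha hb) hc)) hP
  rw [div_mul_eq_mul_div, one_mul, div_eq_div_iff (mul_ne_zero hu hP) hR]
  ring

/-- Pull-back of the level-one box `1/(1−Π)` along the cubical chart: it is `g(t)·x₀³x₁²x₂` with
`g = a(t₀)a(t₁)a(t₂)b(t₃)`, the integrand of `[aaab]`. [folklore] -/
private theorem m4l_pull3 {a b c d : ℝ} (ha : a ≠ 0) (hb : b ≠ 0) (hc : c ≠ 0)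
    (hP : 1 - a * b * c * d ≠ 0) :
    1 / (1 - a * b * c * d) =
      1 / a * (1 / (a * b)) * (1 / (a * b * c)) * (1 / (1 - a * b * c * d)) *
        (a ^ 3 * b ^ 2 * c) := by
  have hR : a * (a * b) * (a * b * c) * (1 - a * b * c * d) ≠ 0 :=
    mul_ne_zero (mul_ne_zero (mul_ne_zero ha (mul_ne_zero ha hb))
      (mul_ne_zero (mul_ne_zero ha hb) hc)) hP
  rw [one_div_mul_one_div, one_div_mul_one_div, one_div_mul_one_div, div_mul_eq_mul_div, one_mul,
    div_eq_div_iff hP hR]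
  ring

/-! ## Carriers: the box of `[ac]`, the stuffle boxes on `□⁴`, the charted box on `Δ₄` -/

/-- Positivity facts at a point of the open unit box `□⁴`: the first three coordinates, the
products `x₀x₁`, `x₂x₃`, and `1 − x₀x₁x₂x₃` are positive. [folklore] -/
private theorem m4l_box_facts {x : Fin 4 → ℝ}
    (hx : x ∈ {x : Fin 4 → ℝ | ∀ i, x i ∈ Set.Ioo (0:ℝ) 1}) :
    0 < x 0 ∧ 0 < x 1 ∧ 0 < x 2 ∧ 0 < x 0 * x 1 ∧ 0 < x 2 * x 3 ∧
      0 < 1 - x 0 * x 1 * x 2 * x 3 := by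
  have h0 : x 0 ∈ Set.Ioo (0:ℝ) 1 := hx 0
  have h1 : x 1 ∈ Set.Ioo (0:ℝ) 1 := hx 1
  have h2 : x 2 ∈ Set.Ioo (0:ℝ) 1 := hx 2
  have h3 : x 3 ∈ Set.Ioo (0:ℝ) 1 := hx 3
  have h01 : 0 < x 0 * x 1 := mul_pos h0.1 h1.1
  have h01' : x 0 * x 1 < 1 := mul_lt_one_of_nonneg_of_lt_one_left h0.1.le h0.2 h1.2.le
  have h23' : x 2 * x 3 < 1 := mul_lt_one_of_nonneg_of_lt_one_left h2.1.le h2.2 h3.2.le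
  have hP : x 0 * x 1 * x 2 * x 3 < 1 := by
    rw [mul_assoc (x 0 * x 1)]
    exact mul_lt_one_of_nonneg_of_lt_one_left h01.le h01' h23'.le
  exact ⟨h0.1, h1.1, h2.1, h01, mul_pos h2.1 h3.1, sub_pos.2 hP⟩

/-- **The box form of the word `ac`.** For any carrier `[Δ₂, a(t₀)c(t₁)]`, the box
`B = [□², 1/(1 + x₀x₁)]` exists (denominator `≥ 1`: bounded and continuous on the closed square)
and is ONE cubical chart `(x₀, x₀x₁)` away from it (rule (2), Jacobian `x₀`,
`m4_box_sub_simplex2`: `a(x₀)c(x₀x₁)·x₀ = 1/(1 + x₀x₁)`).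
[cite: KontsevichZagier2001, §1.2 rule (2)] -/
theorem m4l_exists_acBox (AC : IntegralRep 2)
    (hACd : AC.domain = {t | 0 < t 1 ∧ t 1 < t 0 ∧ t 0 < 1})
    (hACi : AC.integrand = fun t => 1 / t 0 * (1 / (1 + t 1))) :
    ∃ B : IntegralRep 2, B.domain = {x | ∀ i, x i ∈ Set.Ioo (0:ℝ) 1} ∧
      (B.integrand = fun x => 1 / (1 + x 0 * x 1)) ∧ Equivalent B AC := by
  have hB := isSemialgebraic_box 2
  have hsa : IsSemialgebraicFunOn ℚ {x : Fin 2 → ℝ | ∀ i, x i ∈ Set.Ioo (0:ℝ) 1}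
      (fun x => 1 / (1 + x 0 * x 1)) := by
    refine (isSemialgebraicFunOn_aeval_div_aeval hB (1 : MvPolynomial (Fin 2) ℚ)
      (1 + MvPolynomial.X 0 * MvPolynomial.X 1) fun x hx => ?_).congr fun x _ => ?_
    · simp only [map_add, map_one, map_mul, MvPolynomial.aeval_X]
      have h0 := (hx 0).1
      have h1 := (hx 1).1
      positivity
    · simp only [map_add, map_one, map_mul, MvPolynomial.aeval_X]
  have hint : IntegrableOn (fun x : Fin 2 → ℝ => 1 / (1 + x 0 * x 1))
      {x : Fin 2 → ℝ | ∀ i, x i ∈ Set.Ioo (0:ℝ) 1} := by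
    have hc : ContinuousOn (fun x : Fin 2 → ℝ => 1 / (1 + x 0 * x 1)) (Set.Icc 0 1) :=
      continuousOn_const.div (by fun_prop) fun x hx => by
        have h0 : (0:ℝ) ≤ x 0 := hx.1 0
        have h1 : (0:ℝ) ≤ x 1 := hx.1 1
        positivity
    exact (hc.integrableOn_compact isCompact_Icc).mono_set
      fun x hx => ⟨fun i => (hx i).1.le, fun i => (hx i).2.le⟩
  obtain ⟨B, hBd, hBi⟩ : ∃ B : IntegralRep 2, B.domain = {x | ∀ i, x i ∈ Set.Ioo (0:ℝ) 1} ∧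
      B.integrand = fun x => 1 / (1 + x 0 * x 1) := ⟨⟨_, _, hB, hsa, hint⟩, rfl, rfl⟩
  refine ⟨B, hBd, hBi, ?_⟩
  show of B - of AC ∈ relations
  refine m4_box_sub_simplex2 (fun t => 1 / t 0 * (1 / (1 + t 1))) B AC hBd hACd
    (hACi ▸ fun _ _ => rfl) fun x hx => ?_
  have hx' : ∀ i, x i ∈ Set.Ioo (0:ℝ) 1 := by rw [hBd] at hx; exact hx
  have h0 : x 0 ≠ 0 := (hx' 0).1.ne'
  rw [hBi]
  simp only [Matrix.cons_val_zero, Matrix.cons_val_one]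
  exact (m4l_cancel _ h0).symm

/-- **The stuffle boxes exist.** For `p, q : Fin 4`, `[□⁴, 1/((1 + x_p x_q)(1 − x₀x₁x₂x₃))]` is an
integral representation: a quotient of `ℚ`-polynomials with non-vanishing denominator, continuous
on `□⁴`, dominated there by the level-one integrand `1/(1 − x₀x₁x₂x₃)` (`m4t_exists_minusBox4`,
`m4t_exists_box_of_abs_le`). [cite: KontsevichZagier2001, §1.1] -/
theorem m4l_exists_stuffleBox (p q : Fin 4) :
    ∃ T : IntegralRep 4, T.domain = {x | ∀ i, x i ∈ Set.Ioo (0:ℝ) 1} ∧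
      T.integrand = fun x => 1 / ((1 + x p * x q) * (1 - x 0 * x 1 * x 2 * x 3)) := by
  obtain ⟨Z, hZd, hZi⟩ := m4t_exists_minusBox4
  have hne : ∀ x ∈ {x : Fin 4 → ℝ | ∀ i, x i ∈ Set.Ioo (0:ℝ) 1},
      (1 + x p * x q) * (1 - x 0 * x 1 * x 2 * x 3) ≠ 0 := fun x hx =>
    mul_ne_zero (add_pos one_pos (mul_pos (hx p).1 (hx q).1)).ne'
      (m4l_box_facts hx).2.2.2.2.2.ne'
  refine m4t_exists_box_of_abs_le (G := fun x => 1 / (1 - x 0 * x 1 * x 2 * x 3)) ?_ ?_ ?_ ?_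
  · refine (isSemialgebraicFunOn_aeval_div_aeval (isSemialgebraic_box 4)
      (1 : MvPolynomial (Fin 4) ℚ) ((1 + MvPolynomial.X p * MvPolynomial.X q) *
        (1 - MvPolynomial.X 0 * MvPolynomial.X 1 * MvPolynomial.X 2 * MvPolynomial.X 3))
      fun x hx => ?_).congr fun x _ => ?_
    · simp only [map_mul, map_add, map_sub, map_one, MvPolynomial.aeval_X]
      exact hne x hx
    · simp only [map_mul, map_add, map_sub, map_one, MvPolynomial.aeval_X]
  · exact continuousOn_const.div (by fun_prop) hne
  · have h := Z.integrableOn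
    rw [hZd, hZi] at h
    exact h
  · intro x hx
    have hP := (m4l_box_facts hx).2.2.2.2.2
    have hu : 1 ≤ 1 + x p * x q := le_add_of_nonneg_right (mul_pos (hx p).1 (hx q).1).le
    rw [abs_of_pos (one_div_pos.2 (mul_pos (by linarith) hP))]
    exact one_div_le_one_div_of_le hP (le_mul_of_one_le_left hP.le hu)

/-- The charted stuffle box on `Δ₄`, `[Δ₄, 1/(t₀t₁(1+t₁)t₂(1−t₃))]`, exists: a quotient of
`ℚ`-polynomials, continuous on `Δ₄`, dominated by the integrand of the carrier `[aaab]`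
(`1/(1+t₁) ≤ 1`; `m4s_exists_rep_of_abs_le`). [cite: KontsevichZagier2001, §1.1] -/
private theorem m4l_exists_V (AAAB : IntegralRep 4)
    (hAAABd : AAAB.domain = {t | 0 < t 3 ∧ t 3 < t 2 ∧ t 2 < t 1 ∧ t 1 < t 0 ∧ t 0 < 1})
    (hAAABi : AAAB.integrand = fun t => 1 / t 0 * (1 / t 1) * (1 / t 2) * (1 / (1 - t 3))) :
    ∃ V : IntegralRep 4, V.domain = {t | 0 < t 3 ∧ t 3 < t 2 ∧ t 2 < t 1 ∧ t 1 < t 0 ∧ t 0 < 1} ∧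
      V.integrand = fun t => 1 / (t 0 * t 1 * (1 + t 1) * t 2 * (1 - t 3)) := by
  have hpos : ∀ t ∈ {t : Fin 4 → ℝ | 0 < t 3 ∧ t 3 < t 2 ∧ t 2 < t 1 ∧ t 1 < t 0 ∧ t 0 < 1},
      0 < t 0 * t 1 * t 2 * (1 - t 3) ∧ 0 < t 0 * t 1 * (1 + t 1) * t 2 * (1 - t 3) := by
    intro t ht
    have h := m4s_mem_Ioo_of_mem_simplex4 ht
    have h0 := (h 0).1
    have h1 := (h 1).1
    have h2 := (h 2).1
    have h3 : 0 < 1 - t 3 := sub_pos.2 (h 3).2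
    exact ⟨mul_pos (mul_pos (mul_pos h0 h1) h2) h3,
      mul_pos (mul_pos (mul_pos (mul_pos h0 h1) (by linarith)) h2) h3⟩
  have hne : ∀ t ∈ {t : Fin 4 → ℝ | 0 < t 3 ∧ t 3 < t 2 ∧ t 2 < t 1 ∧ t 1 < t 0 ∧ t 0 < 1},
      t 0 * t 1 * (1 + t 1) * t 2 * (1 - t 3) ≠ 0 := fun t ht => (hpos t ht).2.ne'
  refine m4s_exists_rep_of_abs_le
    (G := fun t => 1 / t 0 * (1 / t 1) * (1 / t 2) * (1 / (1 - t 3))) ?_ ?_ ?_ ?_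
  · refine (isSemialgebraicFunOn_aeval_div_aeval m4s_isSemialgebraic_simplex4
      (1 : MvPolynomial (Fin 4) ℚ) (MvPolynomial.X 0 * MvPolynomial.X 1 *
        (1 + MvPolynomial.X 1) * MvPolynomial.X 2 * (1 - MvPolynomial.X 3))
      fun t ht => ?_).congr fun t _ => ?_
    · simp only [map_mul, map_add, map_sub, map_one, MvPolynomial.aeval_X]
      exact hne t ht
    · simp only [map_mul, map_add, map_sub, map_one, MvPolynomial.aeval_X]
  · exact continuousOn_const.div (by fun_prop) hne
  · have h := AAAB.integrableOn
    rw [hAAABd, hAAABi] at h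
    exact h
  · intro t ht
    have h1 : 0 ≤ t 1 := (m4s_mem_Ioo_of_mem_simplex4 ht 1).1.le
    obtain ⟨hA, hL⟩ := hpos t ht
    rw [abs_of_pos (one_div_pos.2 hL), one_div_mul_one_div, one_div_mul_one_div,
      one_div_mul_one_div]
    refine one_div_le_one_div_of_le hA ?_
    calc t 0 * t 1 * t 2 * (1 - t 3) ≤ t 0 * t 1 * t 2 * (1 - t 3) * (1 + t 1) :=
        le_mul_of_one_le_right hA.le (by linarith)
      _ = t 0 * t 1 * (1 + t 1) * t 2 * (1 - t 3) := by ring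

/-! ## The registered sub-goal -/

/-- **Stub `m4_rel_bstuffle22pp` (registered sub-goal of stmt-KontsevichZagierPeriods-3869, line
`SketchIdeator1`, layer `M4` packages).** The box-stuffle `[ac] ⋆ [ac]`:
`P(ac,ac) − [aaab] + 2[acab] ∈ KZ.relations` for arbitrary carriers `[ac]` on `Δ₂` and `[aaab]`,
`[acab]` on `Δ₄` with the displayed integrands (`(ζ(2)/2)² = ζ(4) − 2∫acab = (5/8)ζ(4)` inside the
calculus). Chain of moves: box form of `[ac]` (rule 2) and the product ideal; ONE integrand
additivity on the product box `□⁴` (three-term partial fraction, rule 1b); one coordinate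
permutation (rule 2); two cubical charts `□⁴ → Δ₄` (rule 2); one split on `Δ₄` (rule 1b).
[cite: KontsevichZagier2001, §1.2 rules (1), (2), §4.1] -/
theorem m4_rel_bstuffle22pp :
    ∀ (AC : IntegralRep 2), AC.domain = {t | 0 < t 1 ∧ t 1 < t 0 ∧ t 0 < 1} → (AC.integrand = fun t => 1 / t 0 * (1 / (1 + t 1))) →
      ∀ (AAAB : IntegralRep 4), AAAB.domain = {t | 0 < t 3 ∧ t 3 < t 2 ∧ t 2 < t 1 ∧ t 1 < t 0 ∧ t 0 < 1} → (AAAB.integrand = fun t => 1 / t 0 * (1 / t 1) * (1 / t 2) * (1 / (1 - t 3))) →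
      ∀ (ACAB : IntegralRep 4), ACAB.domain = {t | 0 < t 3 ∧ t 3 < t 2 ∧ t 2 < t 1 ∧ t 1 < t 0 ∧ t 0 < 1} → (ACAB.integrand = fun t => 1 / t 0 * (1 / (1 + t 1)) * (1 / t 2) * (1 / (1 - t 3))) →
      of (AC.prod AC) - of AAAB + (2:ℤ) • of ACAB ∈ relations := by
  intro AC hACd hACi AAAB hAAABd hAAABi ACAB hACABd hACABi
  -- (i) the box form `B = [□², 1/(1+x₀x₁)]` of `[ac]` and the product ideal
  obtain ⟨B, hBd, hBi, hBC⟩ := m4l_exists_acBox AC hACd hACi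
  have hP : of (B.prod B) - of (AC.prod AC) ∈ relations := Equivalent.prod hBC hBC
  -- the product box: domain `□⁴`, integrand `1/((1+x₀x₁)(1+x₂x₃))`
  have hNd : (B.prod B).domain = {x : Fin 4 → ℝ | ∀ i, x i ∈ Set.Ioo (0:ℝ) 1} := by
    ext z
    rw [IntegralRep.prod_domain, IntegralRep.mem_prodDomain, hBd]
    simp only [mem_setOf_eq]
    constructor
    · rintro ⟨h1, h2⟩ i
      exact Fin.addCases (m := 2) (n := 2) (motive := fun i => z i ∈ Set.Ioo (0:ℝ) 1)
        (fun i => h1 i) (fun j => h2 j) i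
    · intro h
      exact ⟨fun i => h _, fun j => h _⟩
  have hNi : ∀ z : Fin 4 → ℝ,
      (B.prod B).integrand z = 1 / (1 + z 0 * z 1) * (1 / (1 + z 2 * z 3)) := by
    intro z
    rw [IntegralRep.prod_integrand_eq, IntegralRep.prodFun_apply, hBi]
    rfl
  -- (ii) the stuffle: rule (1b) on `□⁴` with the three-term partial fraction
  obtain ⟨T1, hT1d, hT1i⟩ := m4l_exists_stuffleBox 0 1
  obtain ⟨T2, hT2d, hT2i⟩ := m4l_exists_stuffleBox 2 3
  obtain ⟨T3, hT3d, hT3i⟩ := m4t_exists_minusBox4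
  have hsplit : of (B.prod B) - ((1:ℤ) • of T1 + (1:ℤ) • of T2 + (-1:ℤ) • of T3) ∈
      relations := by
    have h := aff_orbit_of_sub_sum_zsmul_mem_relations (Finset.univ : Finset (Fin 3))
      ![T1, T2, T3] ![1, 1, -1] (B.prod B) (fun i _ => by
        fin_cases i
        · exact hT1d.trans hNd.symm
        · exact hT2d.trans hNd.symm
        · exact hT3d.trans hNd.symm) fun z hz => ?_
    · simpa [Fin.sum_univ_three] using h
    rw [hNd] at hz
    have hf := m4l_box_facts hz
    rw [hNi z]
    simp only [Fin.sum_univ_three, Matrix.cons_val_zero, Matrix.cons_val_one, Matrix.cons_val_two,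
      Matrix.head_cons, Matrix.tail_cons, hT1i, hT2i, hT3i]
    rw [m4l_partialFraction (add_pos one_pos hf.2.2.2.1).ne' (add_pos one_pos hf.2.2.2.2.1).ne'
      hf.2.2.2.2.2.ne']
    push_cast
    ring
  -- (iii) the permuted stuffle box: `T₂ = T₁ ∘ (x₂, x₃, x₀, x₁)` (rule 2, reindexing)
  obtain ⟨e, he0, he1, he2, he3⟩ : ∃ e : Fin 4 ≃ Fin 4, e 0 = 2 ∧ e 1 = 3 ∧ e 2 = 0 ∧ e 3 = 1 :=
    ⟨⟨![2, 3, 0, 1], ![2, 3, 0, 1], by decide, by decide⟩, rfl, rfl, rfl, rfl⟩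
  have hperm1 : of T2 - of (T1.reindex e) ∈ relations := by
    refine of_sub_of_mem_relations_of_eqOn ?_ fun w _ => ?_
    · rw [IntegralRep.reindex_domain, hT1d, hT2d]
      ext w
      simp only [mem_setOf_eq]
      exact ⟨fun h i => by simpa using h (e.symm i), fun h i => h (e i)⟩
    · rw [IntegralRep.reindex_integrand, hT1i, hT2i]
      simp only [he0, he1, he2, he3]
      ring
  have hperm2 : of T1 - of (T1.reindex e) ∈ relations := of_sub_of_reindex_mem_relations T1 e
  -- (iv) cubical charts `□⁴ → Δ₄` (rule 2): `T₁ ↦ V = [aaab] − [acab]`, `T₃ ↦ [aaab]`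
  obtain ⟨V, hVd, hVi⟩ := m4l_exists_V AAAB hAAABd hAAABi
  have hchart1 : of T1 - of V ∈ relations := by
    refine m4_box_sub_simplex4.1 (fun t => 1 / (t 0 * t 1 * (1 + t 1) * t 2 * (1 - t 3))) T1 V
      hT1d hVd (hVi ▸ fun _ _ => rfl) fun x hx => ?_
    rw [hT1d] at hx
    have hf := m4l_box_facts hx
    rw [hT1i]
    simp only [Matrix.cons_val_zero, Matrix.cons_val_one, Matrix.cons_val_two,
      Matrix.cons_val_three, Matrix.head_cons, Matrix.tail_cons]
    exact m4l_pull1 hf.1.ne' hf.2.1.ne' hf.2.2.1.ne' (add_pos one_pos hf.2.2.2.1).ne'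
      hf.2.2.2.2.2.ne'
  have hVsplit : of V - ((1:ℤ) • of AAAB + (-1:ℤ) • of ACAB) ∈ relations := by
    have h := aff_orbit_of_sub_sum_zsmul_mem_relations (Finset.univ : Finset (Fin 2))
      ![AAAB, ACAB] ![1, -1] V (fun i _ => by
        fin_cases i
        · exact hAAABd.trans hVd.symm
        · exact hACABd.trans hVd.symm) fun t ht => ?_
    · simpa [Fin.sum_univ_two] using h
    rw [hVd] at ht
    have hf := m4s_mem_Ioo_of_mem_simplex4 ht
    rw [hVi]
    simp only [Fin.sum_univ_two, Matrix.cons_val_zero, Matrix.cons_val_one, hAAABi, hACABi]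
    rw [m4l_split (hf 0).1.ne' (hf 1).1.ne' (add_pos one_pos (hf 1).1).ne' (hf 2).1.ne'
      (sub_pos.2 (hf 3).2).ne']
    push_cast
    ring
  have hchart3 : of T3 - of AAAB ∈ relations := by
    refine m4_box_sub_simplex4.1 (fun t => 1 / t 0 * (1 / t 1) * (1 / t 2) * (1 / (1 - t 3))) T3
      AAAB hT3d hAAABd (hAAABi ▸ fun _ _ => rfl) fun x hx => ?_
    rw [hT3d] at hx
    have hf := m4l_box_facts hx
    rw [hT3i]
    simp only [Matrix.cons_val_zero, Matrix.cons_val_one, Matrix.cons_val_two,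
      Matrix.cons_val_three, Matrix.head_cons, Matrix.tail_cons]
    exact m4l_pull3 hf.1.ne' hf.2.1.ne' hf.2.2.1.ne' hf.2.2.2.2.2.ne'
  -- (v) bookkeeping: `P(ac,ac) ≡ [B × B] ≡ T₁ + T₂ − T₃ ≡ 2T₁ − T₃ ≡ 2([aaab] − [acab]) − [aaab]`
  have e' : of (AC.prod AC) - of AAAB + (2:ℤ) • of ACAB =
      -(of (B.prod B) - of (AC.prod AC)) +
        (of (B.prod B) - ((1:ℤ) • of T1 + (1:ℤ) • of T2 + (-1:ℤ) • of T3)) +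
        (of T2 - of (T1.reindex e)) - (of T1 - of (T1.reindex e)) +
        (2:ℤ) • ((of T1 - of V) + (of V - ((1:ℤ) • of AAAB + (-1:ℤ) • of ACAB))) -
        (of T3 - of AAAB) := by
    simp only [one_smul, neg_smul]
    abel
  rw [e']
  exact relations.sub_mem (relations.add_mem (relations.sub_mem (relations.add_mem
    (relations.add_mem (relations.neg_mem hP) hsplit) hperm1) hperm2)
    (relations.zsmul_mem (relations.add_mem hchart1 hVsplit) 2)) hchart3

end Summit.KontsevichZagierPeriods.HurwitzMicroSectors.NormalFormPrinciple.PiBox.M3
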